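import Summits.QuantumFields.YangMills.Theorems.SoloBlindPlaquetteLoop
import Literature.MathematicalPhysics.QuantumFieldTheory.ConstructiveQFTWave0Proofs
import HarnessLib

/-!
# Reflection positivity of the plaquette two-point function (solo-QuantumFields-blind, rung D7)

For Wilson's lattice gauge theory on the even discrete torus `(ℤ/L)^d` with a compact structure
group `G`, a continuous matrix model `ρ : G →* M_N(ℂ)` and `β ≥ 0`, the CONNECTED correlation of a
spatial plaquette energy `φ_p = N − Re tr ρ(U_p)` with its mirror image under the
Osterwalder–Seiler link reflection `θ` (between the time slices `0 | 1`) is non-negative: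

  `⟨φ_p⟩_{Λ,β}² ≤ ⟨φ_{θp} · φ_p⟩_{Λ,β}`     (`wilsonExpectation_plaquetteCost_sq_le_twoPoint`),

for every plaquette `p = (x; i, j)` with spatial directions `i, j ≠ 0`, `i ≠ j`, lying in the
positive-time half `1 ≤ x₀ ≤ L/2`.  This is the first SECOND-MOMENT statement of the solo-blind line
(the rungs D6–D6″ are one-point statements): the positivity structure of the two-point function in
the reflection direction, valid at every coupling and uniformly in the volume, which infrared
arguments (spectral representations of `t ↦ ⟨φ_p ; φ_{p + t e₀}⟩`, monotonicity/convexity in `t`,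
and the no-clustering Theorem B of the accompanying paper `local-gaussianity.md`, step 3.4) start
from.

Ingredients, all proved here or in the tree: Osterwalder–Seiler reflection positivity of the
torus Wilson state (`wilsonExpectation_reflectionPositive_holds`, tree), the computation
`U^θ_p = U_{θp}` for spatial plaquettes (`plaquetteHolonomy_timeReflect`: the reflection carries
spatial links along without inversion and commutes with spatial shifts), the positive-time support
of `φ_p` (`isPositiveTimeObservable_plaquetteCost`), and the equality of all single-plaquette
expectations (`wilsonExpectation_plaquetteCost_eq`, rung D6′), which identifies `⟨φ_{θp}⟩ = ⟨φ_p⟩`.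

References: K. Osterwalder, E. Seiler, Ann. Phys. 110 (1978) 440, §2; E. Seiler, LNP 159 (1982)
Ch. 2; J. Glimm, A. Jaffe, *Quantum Physics* (1987) §6.1 (RP ⇒ positivity of two-point functions
in the reflected geometry). [folklore consequences of OS positivity; the typed torus statements are
this unit's]
-/

open MeasureTheory
open Literature.MathematicalPhysics.QuantumFieldTheory Literature.RepresentationTheory.CompactGroups

noncomputable section

namespace Summit.QuantumFields.YangMills.Theorems.SoloBlind

section Reflection

variable {d L N : ℕ} [NeZero d] {G : Type*} [Group G]

/-- For SPATIAL directions `i, j ≠ 0` the plaquette holonomy of the time-reflected configuration is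
the holonomy of the reflected plaquette: `(ΘU)_{x;ij} = U_{θx;ij}` (spatial links are carried along
by `Θ` without inversion, and `θ` commutes with spatial shifts). [folklore] -/
theorem plaquetteHolonomy_timeReflect (U : GaugeConfig d L G) (x : Site d L) {i j : Fin d}
    (hi : i ≠ 0) (hj : j ≠ 0) :
    plaquetteHolonomy U.timeReflect x i j = plaquetteHolonomy U x.timeReflect i j := by
  simp only [plaquetteHolonomy, GaugeConfig.timeReflect, hi, hj, if_false,
    WilsonRP.timeReflect_shift_of_ne _ hi, WilsonRP.timeReflect_shift_of_ne _ hj]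

variable (ρ : G →* Matrix (Fin N) (Fin N) ℂ)

/-- `φ_{x;ij}(ΘU) = φ_{θx;ij}(U)` for spatial `i, j`. [folklore] -/
theorem plaquetteCost_timeReflect (U : GaugeConfig d L G) (x : Site d L) {i j : Fin d}
    (hi : i ≠ 0) (hj : j ≠ 0) :
    plaquetteCost ρ x i j U.timeReflect = plaquetteCost ρ x.timeReflect i j U := by
  unfold plaquetteCost
  rw [plaquetteHolonomy_timeReflect U x hi hj]

/-- A spatial plaquette energy at a site of the positive-time half `1 ≤ x₀ ≤ L/2` is a positive-time
observable in the sense of Osterwalder–Seiler (it depends only on links with both endpoints in the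
half). [folklore] -/
theorem isPositiveTimeObservable_plaquetteCost (x : Site d L) {i j : Fin d} (hi : i ≠ 0)
    (hj : j ≠ 0) (hx1 : 1 ≤ (x 0).val) (hx2 : (x 0).val ≤ L / 2) :
    IsPositiveTimeObservable (plaquetteCost (G := G) ρ x i j) := by
  intro U V hUV
  have key : ∀ (y : Site d L) (k : Fin d), y 0 = x 0 → k ≠ 0 → U (y, k) = V (y, k) := by
    intro y k hy hk
    have hs : (y.shift k) 0 = y 0 := WilsonRP.shift_apply_of_ne y (Ne.symm hk)
    refine hUV (y, k) ?_ ?_ ?_ ?_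
    · simpa [hy] using hx1
    · simpa [hy] using hx2
    · simpa [hs, hy] using hx1
    · simpa [hs, hy] using hx2
  have h1 : (x.shift i) 0 = x 0 := WilsonRP.shift_apply_of_ne x (Ne.symm hi)
  have h2 : (x.shift j) 0 = x 0 := WilsonRP.shift_apply_of_ne x (Ne.symm hj)
  unfold plaquetteCost plaquetteHolonomy
  rw [key x i rfl hi, key (x.shift i) j h1 hj, key (x.shift j) i h2 hi, key x j rfl hj]

/-- The same for any real function of the plaquette energy shifted by a constant. [folklore] -/
theorem isPositiveTimeObservable_plaquetteCost_sub (x : Site d L) {i j : Fin d} (hi : i ≠ 0)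
    (hj : j ≠ 0) (hx1 : 1 ≤ (x 0).val) (hx2 : (x 0).val ≤ L / 2) (c : ℝ) :
    IsPositiveTimeObservable (fun U : GaugeConfig d L G => ((plaquetteCost ρ x i j U - c : ℝ) : ℂ)) := by
  intro U V hUV
  simp only [isPositiveTimeObservable_plaquetteCost ρ x hi hj hx1 hx2 U V hUV]

end Reflection

section TwoPoint

variable {d L N : ℕ} [NeZero d] [NeZero L] {G : Type*} [Group G] [TopologicalSpace G]
  [IsTopologicalGroup G] [CompactSpace G] [MeasurableSpace G] [BorelSpace G]
  (ρ : G →* Matrix (Fin N) (Fin N) ℂ)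

/-- Reflection positivity applied to the centred plaquette energy: for `β ≥ 0`, `L` even, a spatial
plaquette `(x; i, j)` in the positive-time half and any constant `c`,
`0 ≤ ⟨(φ_{θx;ij} − c)(φ_{x;ij} − c)⟩_{Λ,β}`. [folklore] -/
theorem wilsonExpectation_centred_twoPoint_nonneg (hL : Even L) (hρ : Continuous ρ) {β : ℝ}
    (hβ : 0 ≤ β) (x : Site d L) {i j : Fin d} (hi : i ≠ 0) (hj : j ≠ 0) (hx1 : 1 ≤ (x 0).val)
    (hx2 : (x 0).val ≤ L / 2) (c : ℝ) :
    0 ≤ wilsonExpectation ρ β fun U =>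
      (plaquetteCost ρ x.timeReflect i j U - c) * (plaquetteCost ρ x i j U - c) := by
  set F : GaugeConfig d L G → ℂ := fun U => ((plaquetteCost ρ x i j U - c : ℝ) : ℂ) with hF
  have hFm : Measurable F :=
    Complex.measurable_ofReal.comp ((measurable_plaquetteCost' ρ hρ x i j).sub_const c)
  have hFb : ∃ C : ℝ, ∀ U, ‖F U‖ ≤ C := by
    refine ⟨2 * N + |c|, fun U => ?_⟩
    rw [hF]
    simp only [Complex.norm_real, Real.norm_eq_abs]
    calc |plaquetteCost ρ x i j U - c| ≤ |plaquetteCost ρ x i j U| + |c| := abs_sub _ _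
      _ ≤ 2 * N + |c| := by gcongr; exact abs_plaquetteCost_le ρ hρ x i j U
  have hFpos : IsPositiveTimeObservable F := isPositiveTimeObservable_plaquetteCost_sub ρ x hi hj hx1 hx2 c
  have hRP := wilsonExpectation_reflectionPositive_holds (d := d) (L := L) ρ hL hρ hβ F hFm hFb hFpos
  -- the integrand is the real number `(φ_{θx} U - c) (φ_x U - c)`
  have hint : (fun U : GaugeConfig d L G => (starRingEnd ℂ) (F U.timeReflect) * F U) =
      fun U => (((plaquetteCost ρ x.timeReflect i j U - c) * (plaquetteCost ρ x i j U - c) : ℝ) : ℂ) := by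
    funext U
    rw [hF]
    simp only [plaquetteCost_timeReflect ρ U x hi hj, Complex.conj_ofReal, Complex.ofReal_mul]
  rw [hint] at hRP
  unfold wilsonExpectation at hRP ⊢
  rw [integral_complex_ofReal] at hRP
  exact Complex.zero_le_real.mp hRP

/-- **Reflection positivity of the plaquette two-point function** (rung D7).  For `β ≥ 0`, `L`
even, and a spatial plaquette `p = (x; i, j)` (`i, j ≠ 0`, `i ≠ j`) in the positive-time half
`1 ≤ x₀ ≤ L/2`, the connected correlation of `φ_p` with its mirror image `φ_{θp}` is non-negative:
`⟨φ_p⟩² ≤ ⟨φ_{θp} φ_p⟩`, i.e. `Cov(φ_{θp}, φ_p) ≥ 0` (using `⟨φ_{θp}⟩ = ⟨φ_p⟩`, rung D6′). -/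
theorem wilsonExpectation_plaquetteCost_sq_le_twoPoint (hL : Even L) (hρ : Continuous ρ) {β : ℝ}
    (hβ : 0 ≤ β) (x : Site d L) {i j : Fin d} (hi : i ≠ 0) (hj : j ≠ 0) (hij : i ≠ j)
    (hx1 : 1 ≤ (x 0).val) (hx2 : (x 0).val ≤ L / 2) :
    (wilsonExpectation ρ β (plaquetteCost ρ x i j)) ^ 2 ≤
      wilsonExpectation ρ β fun U => plaquetteCost ρ x.timeReflect i j U * plaquetteCost ρ x i j U := by
  haveI := isProbabilityMeasure_wilsonMeasure (d := d) (L := L) (G := G) ρ hρ β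
  set c := wilsonExpectation ρ β (plaquetteCost ρ x i j) with hc
  have hcθ : wilsonExpectation ρ β (plaquetteCost ρ x.timeReflect i j) = c := by
    rw [hc, wilsonExpectation_plaquetteCost_eq ρ hρ β x.timeReflect hij hij,
      wilsonExpectation_plaquetteCost_eq ρ hρ β x hij hij]
  have h0 := wilsonExpectation_centred_twoPoint_nonneg ρ hL hρ hβ x hi hj hx1 hx2 c
  -- abbreviations and integrability
  set A : GaugeConfig d L G → ℝ := plaquetteCost ρ x.timeReflect i j with hA
  set B : GaugeConfig d L G → ℝ := plaquetteCost ρ x i j with hB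
  have hAi : Integrable A (wilsonMeasure ρ β) := integrable_plaquetteCost' ρ hρ β _ i j
  have hBi : Integrable B (wilsonMeasure ρ β) := integrable_plaquetteCost' ρ hρ β _ i j
  have hABi : Integrable (fun U => A U * B U) (wilsonMeasure ρ β) := by
    refine Integrable.of_bound
      ((measurable_plaquetteCost' ρ hρ _ i j).mul (measurable_plaquetteCost' ρ hρ _ i j)).aestronglyMeasurable
      (2 * N * (2 * N)) (ae_of_all _ fun U => ?_)
    rw [Real.norm_eq_abs, abs_mul]
    exact mul_le_mul (abs_plaquetteCost_le ρ hρ _ i j U) (abs_plaquetteCost_le ρ hρ _ i j U)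
      (abs_nonneg _) (by positivity)
  -- expand the centred product
  have hexp : (fun U => (A U - c) * (B U - c)) = fun U => A U * B U - c * A U - c * B U + c ^ 2 := by
    funext U; ring
  have hE : wilsonExpectation ρ β (fun U => (A U - c) * (B U - c)) =
      wilsonExpectation ρ β (fun U => A U * B U) - c * wilsonExpectation ρ β A
        - c * wilsonExpectation ρ β B + c ^ 2 := by
    have i2 : Integrable (fun U => A U * B U - c * A U) (wilsonMeasure ρ β) := hABi.sub (hAi.const_mul c)
    have i3 : Integrable (fun U => A U * B U - c * A U - c * B U) (wilsonMeasure ρ β) :=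
      i2.sub (hBi.const_mul c)
    unfold wilsonExpectation
    rw [hexp, integral_add i3 (integrable_const _), integral_sub i2 (hBi.const_mul c),
      integral_sub hABi (hAi.const_mul c), integral_const_mul, integral_const_mul, integral_const]
    simp [Measure.real]
  have hEA : wilsonExpectation ρ β A = c := hcθ
  have hEB : wilsonExpectation ρ β B = c := hc.symm
  rw [hE, hEA, hEB] at h0
  nlinarith [h0]

/-- **Translated form.**  By translation invariance of the torus Wilson state the mirror pair may
be moved anywhere: for every `v`, `⟨φ⟩² ≤ ⟨φ_{θx + v; ij} · φ_{x + v; ij}⟩`.  As `x₀ = t` runs over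
`1 ≤ t ≤ L/2` and `v` over the torus, the pairs `(θx + v, x + v)` are exactly the pairs of parallel
spatial `(i, j)`-plaquettes with equal spatial coordinates and ODD time separation `2t − 1`
(`1, 3, …, L − 1`): the connected two-point function `t ↦ G(t) = ⟨φ_p ; φ_{p + t e₀}⟩_{Λ,β}` is
non-negative at every odd `t`, for every `β ≥ 0` and every even `L`. -/
theorem wilsonExpectation_plaquetteCost_sq_le_twoPoint_translate (hL : Even L) (hρ : Continuous ρ)
    {β : ℝ} (hβ : 0 ≤ β) (x : Site d L) {i j : Fin d} (hi : i ≠ 0) (hj : j ≠ 0) (hij : i ≠ j)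
    (hx1 : 1 ≤ (x 0).val) (hx2 : (x 0).val ≤ L / 2) (v : Site d L) :
    (wilsonExpectation ρ β (plaquetteCost ρ x i j)) ^ 2 ≤
      wilsonExpectation ρ β fun U =>
        plaquetteCost ρ (x.timeReflect + v) i j U * plaquetteCost ρ (x + v) i j U := by
  have h := wilsonExpectation_plaquetteCost_sq_le_twoPoint ρ hL hρ hβ x hi hj hij hx1 hx2
  have ht : wilsonExpectation ρ β (fun U =>
        plaquetteCost ρ (x.timeReflect + v) i j U * plaquetteCost ρ (x + v) i j U) =
      wilsonExpectation ρ β (fun U =>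
        plaquetteCost ρ x.timeReflect i j U * plaquetteCost ρ x i j U) := by
    rw [← wilsonExpectation_comp_torusConfigShift ρ β (-v) (fun U =>
        plaquetteCost ρ x.timeReflect i j U * plaquetteCost ρ x i j U)]
    congr 1
    funext U
    simp only [Function.comp_apply, plaquetteCost, plaquetteHolonomy_torusConfigShift, sub_neg_eq_add]
  rw [ht]
  exact h

/-- The expectation on the left may be that of ANY genuine plaquette (all single-plaquette
expectations agree, rung D6′): `⟨φ_{y; i′j′}⟩² ≤ ⟨φ_{θx + v; ij} φ_{x + v; ij}⟩`. -/
theorem wilsonExpectation_plaquetteCost_sq_le_twoPoint' (hL : Even L) (hρ : Continuous ρ)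
    {β : ℝ} (hβ : 0 ≤ β) (x : Site d L) {i j : Fin d} (hi : i ≠ 0) (hj : j ≠ 0) (hij : i ≠ j)
    (hx1 : 1 ≤ (x 0).val) (hx2 : (x 0).val ≤ L / 2) (v y : Site d L) {i' j' : Fin d}
    (hij' : i' ≠ j') :
    (wilsonExpectation ρ β (plaquetteCost ρ y i' j')) ^ 2 ≤
      wilsonExpectation ρ β fun U =>
        plaquetteCost ρ (x.timeReflect + v) i j U * plaquetteCost ρ (x + v) i j U := by
  rw [wilsonExpectation_plaquetteCost_eq ρ hρ β y hij' hij, ← wilsonExpectation_plaquetteCost_eq ρ hρ β x hij hij]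
  exact wilsonExpectation_plaquetteCost_sq_le_twoPoint_translate ρ hL hρ hβ x hi hj hij hx1 hx2 v

end TwoPoint

end Summit.QuantumFields.YangMills.Theorems.SoloBlind

end
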